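import Literature.MathematicalPhysics.QuantumFieldTheory.TomboulisVortexDecimation
import HarnessLib

/-!
# Tomboulis (2.13): the exponent bookkeeping («the row corrects the constant, the argument survives»)

Tomboulis, arXiv:0707.2179, Prop. II.1(ii), eq. (2.13): `Z_Λ({c_j}) ≥ [1 + Σ_j d_j² c_j⁶]^{|Λ|}` with
`|Λ|` = number of plaquettes (App. A §3); the printed proof (App. A (A.1)–(A.5)) delivers the exponent
«number of sites», and downstream only `Z > 1` ((2.14)) and the exponent `#plaquettes / b^d` of (B.15)
are used. In the tree's vocabulary (`Tomboulis2007.HypercubeLowerBoundExp d L J m`: the bound with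
exponent `m`; `HypercubeLowerBound d L J`: exponent `L^d` = #sites) this file records the trivial
implications that make «the argument survives the correction of the constant» precise:

* `hypercubeLowerBoundExp_anti` — the bound is antitone in the exponent (the base is `≥ 1`);
* `hypercubeLowerBoundExp_of_hypercubeLowerBound` — the #sites form gives every exponent `m ≤ L^d`,
  in particular the (B.15) exponent whenever `#plaquettes / b^d ≤ L^d`;
* `one_le_torusZ_of_hypercubeLowerBoundExp` — any instance gives `Z ≥ 1` ((2.14), weak form).

[cite: Tomboulis2007Confinement, Prop. II.1(ii) eq. (2.13)–(2.14); App. A (A.4)–(A.5); App. B (B.15)]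
-/

noncomputable section

open Finset

namespace Literature.MathematicalPhysics.QuantumFieldTheory.Tomboulis2007

variable {d L : ℕ} [NeZero L]

/-- The base of (2.13) is at least `1` for admissible (indeed any real) coefficients. [folklore] -/
private theorem one_le_base (J : ℕ) (c : ℕ → ℝ) :
    (1 : ℝ) ≤ 1 + ∑ n ∈ Icc 1 J, ((n : ℝ) + 1) ^ 2 * c n ^ 6 :=
  le_add_of_nonneg_right (sum_nonneg fun n _ => by positivity)

/-- (2.13) is ANTITONE in the exponent: if it holds with exponent `m` it holds with every `m' ≤ m`
(the base is `≥ 1`). [cite: Tomboulis2007Confinement, Prop. II.1(ii) eq. (2.13)] -/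
theorem hypercubeLowerBoundExp_anti {J m m' : ℕ} (hm : m' ≤ m)
    (h : HypercubeLowerBoundExp d L J m) : HypercubeLowerBoundExp d L J m' :=
  fun c hc => (pow_le_pow_right₀ (one_le_base J c) hm).trans (h c hc)

/-- The #sites form (what App. A (A.1)–(A.5) proves) gives (2.13) with every exponent `m ≤ L^d` — in
particular the exponent `#plaquettes / b^d` used in (B.15) whenever that number is `≤ L^d`.
[cite: Tomboulis2007Confinement, App. A eq. (A.4)–(A.5) and App. B eq. (B.15)] -/
theorem hypercubeLowerBoundExp_of_hypercubeLowerBound {J m : ℕ} (hm : m ≤ L ^ d)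
    (h : HypercubeLowerBound d L J) : HypercubeLowerBoundExp d L J m :=
  fun c hc => (pow_le_pow_right₀ (one_le_base J c) hm).trans (h c hc)

/-- The #sites form is the instance `m = L^d`. [cite: Tomboulis2007Confinement, App. A eq. (A.4)] -/
theorem hypercubeLowerBound_iff_exp {J : ℕ} :
    HypercubeLowerBound d L J ↔ HypercubeLowerBoundExp d L J (L ^ d) := Iff.rfl

/-- Any instance of (2.13) gives the weak form of (2.14): `Z_Λ({c_j}) ≥ 1`.
[cite: Tomboulis2007Confinement, Prop. II.1(ii) eq. (2.14)] -/
theorem one_le_torusZ_of_hypercubeLowerBoundExp {J m : ℕ} (h : HypercubeLowerBoundExp d L J m)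
    {c : ℕ → ℝ} (hc : CoeffAdmissible c) : 1 ≤ torusZ d L J c :=
  (one_le_pow₀ (one_le_base J c)).trans (h c hc)

end Literature.MathematicalPhysics.QuantumFieldTheory.Tomboulis2007
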